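import Summits.Ventures.Crystal3D.Theorems.StickyWulffConstantCoaxialWallLawPlateDescent
import Summits.Ventures.Crystal3D.Theorems.StickyWulffConstantCoaxialWallLawSealedCredits
import Summits.Ventures.Crystal3D.Theorems.StickyWulffConstantCoaxialWallLawTerracePropagation
import HarnessLib

/-!
# The plate foot: a twin-capped ball over the bottom sample is joined, down its coherent plate, to an unsaturated ball

HONEST FRAMING. Part of the venture `Summits/Ventures/Crystal3D` (cell `crystal3d-full`), helper
`--supports` the crux `CoaxialWallLaw` (stmt-Ventures-19481, `route-Ventures-StickyWulffConstant`),
REGISTERED line `WallLedgerF` (planner cf-p1 gen 16), stub `stub_coaxialTwoSlabAdhesion`.  Local engine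
for paying the FOREIGN-twin-capped exits of the co-axial general-filling ledgers (`…NetRung`) at finite
thickness: the residual `#FTC` of those rungs is turned into payers at distance `O(1+h)`.  Rung credit
only; F-C1 not moved.

**Theorem (`twinDozen_plateFoot_payer`).**  Bottom sample `P ⊆ X` of the grain `Λ = A·Λ₀ + t` complete on
`[−2R₀, −R₀] × disc ρ` (`R₀ ≥ 3`), `X` `1`-separated with floor `−2R₀`; inputs `KissingGap δ`,
`KissingClassification δ` BY NAME (through 19481-p2's terrace propagation `twinDozen_inPlane_propagate`).
Let `e ∈ X` be a TWIN DOZEN of the grain for a unit menu normal `n` (own nine slots occupied, far three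
empty — the cap structure of the exit lemma) whose plate is NOT horizontal:
`δ₀ ≤ (√3/2)·√(1 − ⟪n, e₃⟫²)` with `δ₀ > 0`; let `K : ℕ` with `e₂ + R₀ + 1 ≤ K·δ₀` and `e` at lateral radius
`≤ ρ − K − 3`.  Then there are far slots `uᵢ ≠ uⱼ`, a step count `k ≤ K` and balls `y, z ∈ X` with
`y = e + k·A(uᵢ − uⱼ)`, `−R₀ − 2 < y₂ ≤ e₂`, `z` UNSATURATED (`deg z ≠ 12`) and `z = y ∨ dist y z = 1`.
Mechanism: walk down the plate along the descending in-plane slot of `exists_descent_farDiff`; the walk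
cannot enter the sealed sample as a twin dozen (there all twelve slots are occupied,
`mem_sample_bottom_of_deep_sealed` + completeness), so there is a first step at which the twin-dozen
structure is lost; at that step terrace propagation (contrapositive) exhibits an unsaturated ball within
contact distance one.

WHAT THIS IS NOT: no counting (the map exit ↦ payer has fibres `O(K)`; next file); not the stub; F-C1 not
moved.
-/

noncomputable section

namespace Summit.Ventures.Crystal3D.Theorems

open Summit.Ventures.Crystal3D Finset
open Literature.MathematicalPhysics.StatisticalMechanics (fccStacking)
open scoped InnerProductSpace

/-- Height of a translate along a multiple of a slot: `(e + k • v) 2 = e 2 + k ⟪v, e₃⟫`. -/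
theorem apply_two_add_smul (e v : EuclideanSpace ℝ (Fin 3)) (k : ℝ) :
    (e + k • v) 2 = e 2 + k * ⟪v, EuclideanSpace.single (2 : Fin 3) (1 : ℝ)⟫_ℝ := by
  rw [PiLp.add_apply, PiLp.smul_apply, smul_eq_mul, apply_two_eq_inner_e₃ v]

open scoped Classical in
/-- **The plate foot.**  See the module docstring. -/
theorem twinDozen_plateFoot_payer {δ : ℝ} (hg : KissingGap δ) (hc : KissingClassification δ)
    (A : EuclideanSpace ℝ (Fin 3) ≃ₗᵢ[ℝ] EuclideanSpace ℝ (Fin 3)) (t : EuclideanSpace ℝ (Fin 3))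
    (X P : Finset (EuclideanSpace ℝ (Fin 3))) (R₀ ρ : ℝ) (hR₀ : 4 ≤ R₀) (hρ : R₀ ≤ ρ)
    (hX : ∀ p ∈ X, ∀ q ∈ X, p ≠ q → 1 ≤ dist p q) (hPX : P ⊆ X)
    (hfloor : ∀ p ∈ X, -(2 * R₀) ≤ p 2)
    (hP : ∀ p, p ∈ P ↔ (p ∈ (fun q => A q + t) '' fccStacking 1 (Real.sqrt (2 / 3)) ∧
      -(2 * R₀) ≤ p 2 ∧ p 2 ≤ -R₀ ∧ p 0 ^ 2 + p 1 ^ 2 ≤ ρ ^ 2))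
    {n : EuclideanSpace ℝ (Fin 3)} (hn : ‖n‖ = 1)
    (hmenu : ∀ w ∈ fccSlots, ⟪A w, n⟫_ℝ = 0 ∨ ⟪A w, n⟫_ℝ = Real.sqrt (2 / 3) ∨ ⟪A w, n⟫_ℝ = -Real.sqrt (2 / 3))
    {δ₀ : ℝ} (hδ₀ : 0 < δ₀)
    (hδ : δ₀ ≤ Real.sqrt 3 / 2 * Real.sqrt (1 - ⟪n, EuclideanSpace.single (2 : Fin 3) (1 : ℝ)⟫_ℝ ^ 2))
    {e : EuclideanSpace ℝ (Fin 3)} (he : e ∈ X) (he₂ : -R₀ - 3 < e 2)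
    (hown : ∀ w ∈ fccSlots, ⟪A w, n⟫_ℝ ≤ 0 → e + A w ∈ X)
    (hfar : ∀ w ∈ fccSlots, 0 < ⟪A w, n⟫_ℝ → e + A w ∉ X)
    (K : ℕ) (hK : e 2 + R₀ + 1 ≤ K * δ₀) (her : e 0 ^ 2 + e 1 ^ 2 ≤ (ρ - K - 3) ^ 2) (hρK : (K : ℝ) + 3 ≤ ρ) :
    ∃ uᵢ ∈ fccSlots, ∃ uⱼ ∈ fccSlots, ∃ k : ℕ, k ≤ K ∧
      ∃ z ∈ X, (X.filter fun q => dist z q = 1).card ≠ 12 ∧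
        (z = e + (k : ℝ) • A (uᵢ - uⱼ) ∨ dist (e + (k : ℝ) • A (uᵢ - uⱼ)) z = 1) ∧
        -R₀ - 2 < (e + (k : ℝ) • A (uᵢ - uⱼ)) 2 ∧ (e + (k : ℝ) • A (uᵢ - uⱼ)) 2 ≤ e 2 := by
  have hR₀3 : (3 : ℝ) ≤ R₀ := by linarith
  obtain ⟨uᵢ, hi, uⱼ, hj, hij, hipos, hjpos, hdesc⟩ := exists_descent_farDiff A hn hmenu
  obtain ⟨d, hd⟩ : ∃ d : EuclideanSpace ℝ (Fin 3), d = A (uᵢ - uⱼ) := ⟨_, rfl⟩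
  rw [← hd] at hdesc
  have iij : ⟪uᵢ, uⱼ⟫_ℝ = 1 / 2 := inner_eq_half_of_pos_pos A hn hmenu hi hj hij hipos hjpos
  have hslot : uᵢ - uⱼ ∈ fccSlots := sub_mem_fccSlots_of_inner_eq_half hi hj iij
  have hσ : ⟪d, EuclideanSpace.single (2 : Fin 3) (1 : ℝ)⟫_ℝ ≤ -δ₀ := by linarith
  have hσ1 : -1 ≤ ⟪d, EuclideanSpace.single (2 : Fin 3) (1 : ℝ)⟫_ℝ := by
    rw [hd]; exact (abs_le.1 (abs_inner_slot_le_one A hslot)).1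
  have hdn : ⟪d, n⟫_ℝ = 0 := by
    have hrpos : 0 < Real.sqrt (2 / 3) := Real.sqrt_pos.2 (by norm_num)
    have vi : ⟪A uᵢ, n⟫_ℝ = Real.sqrt (2 / 3) := by
      rcases hmenu uᵢ hi with h | h | h <;> [linarith; exact h; linarith]
    have vj : ⟪A uⱼ, n⟫_ℝ = Real.sqrt (2 / 3) := by
      rcases hmenu uⱼ hj with h | h | h <;> [linarith; exact h; linarith]
    rw [hd, map_sub, inner_sub_left, vi, vj, sub_self]
  have hdnorm : ‖d‖ = 1 := by rw [hd, LinearIsometryEquiv.norm_map, norm_eq_one_of_mem_fccSlots hslot]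
  -- a far slot next to a deep non-rim ball is occupied
  have far_mem : ∀ {q : EuclideanSpace ℝ (Fin 3)}, q ∈ X → q 2 ≤ -R₀ - 1 → -R₀ - 3 < q 2 →
      q 0 ^ 2 + q 1 ^ 2 ≤ (ρ - 3) ^ 2 → q + A uᵢ ∈ X := by
    intro q hq hq2 hq2' hqr
    have hr : q 0 ^ 2 + q 1 ^ 2 ≤ (ρ - 1) ^ 2 := by nlinarith
    have hqP : q ∈ P := mem_sample_bottom_of_deep_sealed A t X P R₀ ρ hR₀3 hρ hX hPX hfloor hP hq hq2 hr
    obtain ⟨hqΛ, -, -, -⟩ := (hP q).1 hqP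
    have h2 : (q + A uᵢ) 2 = q 2 + ⟪A uᵢ, EuclideanSpace.single (2 : Fin 3) (1 : ℝ)⟫_ℝ := by
      rw [PiLp.add_apply, apply_two_eq_inner_e₃ (A uᵢ)]
    have hb := abs_le.1 (abs_inner_slot_le_one A hi)
    refine hPX ((hP _).2 ⟨movedFcc_add_site_mem A t hqΛ (mem_fcc_of_mem_fccSlots hi), ?_, ?_, ?_⟩)
    · rw [h2]; linarith [hb.1]
    · rw [h2]; linarith [hb.2]
    · have h0' : (0 : ℝ) ≤ ρ - 1 := by linarith
      have := lateral_sq_add_le q (A uᵢ) h0' hr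
      rw [LinearIsometryEquiv.norm_map, norm_eq_one_of_mem_fccSlots hi] at this
      nlinarith
  -- the walk `y k = e + k • d` and its heights
  obtain ⟨y, hydef⟩ : ∃ y : ℕ → EuclideanSpace ℝ (Fin 3), ∀ k, y k = e + (k : ℝ) • d := ⟨_, fun _ => rfl⟩
  have hy0 : y 0 = e := by rw [hydef]; simp
  have hysucc : ∀ k : ℕ, y (k + 1) = y k + d := by
    intro k; rw [hydef, hydef]; push_cast; rw [add_smul, one_smul, add_assoc]
  have hyh : ∀ k : ℕ, (y k) 2 = e 2 + k * ⟪d, EuclideanSpace.single (2 : Fin 3) (1 : ℝ)⟫_ℝ := by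
    intro k; rw [hydef]; exact apply_two_add_smul e d k
  have hylat : ∀ k : ℕ, k ≤ K → (y k) 0 ^ 2 + (y k) 1 ^ 2 ≤ (ρ - 3) ^ 2 := by
    intro k hk
    have h0 : (0 : ℝ) ≤ ρ - K - 3 := by linarith
    have := lateral_sq_add_le e ((k : ℝ) • d) h0 her
    have hk0 : (0 : ℝ) ≤ k := Nat.cast_nonneg k
    rw [norm_smul, hdnorm, mul_one, Real.norm_eq_abs, abs_of_nonneg hk0] at this
    have hkK : (k : ℝ) ≤ K := by exact_mod_cast hk
    have h1 : (ρ - ↑K - 3 + ↑k) ^ 2 ≤ (ρ - 3) ^ 2 := by nlinarith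
    rw [hydef]; exact this.trans h1
  -- the twin-dozen property along the walk
  obtain ⟨T, hTdef⟩ : ∃ T : ℕ → Prop, ∀ k, T k ↔ (y k ∈ X ∧ (∀ w ∈ fccSlots, ⟪A w, n⟫_ℝ ≤ 0 → y k + A w ∈ X) ∧
      (∀ w ∈ fccSlots, 0 < ⟪A w, n⟫_ℝ → y k + A w ∉ X)) := ⟨_, fun _ => Iff.rfl⟩
  have hT0 : T 0 := (hTdef 0).2 (by rw [hy0]; exact ⟨he, hown, hfar⟩)
  -- the first `k` with height `≤ −R₀ − 1`
  have hdeepK : (y K) 2 ≤ -R₀ - 1 := by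
    rw [hyh]
    have h1 : (K : ℝ) * (⟪d, EuclideanSpace.single (2 : Fin 3) (1 : ℝ)⟫_ℝ + δ₀) ≤ 0 :=
      mul_nonpos_iff.2 (Or.inl ⟨Nat.cast_nonneg K, by linarith⟩)
    have h2 : (K : ℝ) * (⟪d, EuclideanSpace.single (2 : Fin 3) (1 : ℝ)⟫_ℝ + δ₀) =
        (K : ℝ) * ⟪d, EuclideanSpace.single (2 : Fin 3) (1 : ℝ)⟫_ℝ + K * δ₀ := by ring
    linarith
  have hexdeep : ∃ k : ℕ, (y k) 2 ≤ -R₀ - 1 := ⟨K, hdeepK⟩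
  obtain ⟨k₁, hk₁def⟩ : ∃ k₁ : ℕ, k₁ = Nat.find hexdeep := ⟨_, rfl⟩
  have hk₁h : (y k₁) 2 ≤ -R₀ - 1 := by rw [hk₁def]; exact Nat.find_spec hexdeep
  have hk₁K : k₁ ≤ K := by rw [hk₁def]; exact Nat.find_min' hexdeep hdeepK
  have hk₁pos : 0 < k₁ := by
    rcases Nat.eq_zero_or_pos k₁ with h0 | hpos
    · exfalso
      rw [h0, hy0] at hk₁h
      have hr : e 0 ^ 2 + e 1 ^ 2 ≤ (ρ - 3) ^ 2 := by have := hylat 0 (Nat.zero_le _); rwa [hy0] at this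
      exact hfar uᵢ hi hipos (far_mem he hk₁h he₂ hr)
    · exact hpos
  have hk₁lo : -R₀ - 2 < (y k₁) 2 := by
    have hprev : ¬ (y (k₁ - 1)) 2 ≤ -R₀ - 1 := by
      rw [hk₁def]; exact Nat.find_min hexdeep (by rw [← hk₁def]; exact Nat.sub_lt hk₁pos Nat.one_pos)
    push Not at hprev
    have e1 : k₁ = (k₁ - 1) + 1 := (Nat.sub_add_cancel hk₁pos).symm
    have : (y k₁) 2 = (y (k₁ - 1)) 2 + ⟪d, EuclideanSpace.single (2 : Fin 3) (1 : ℝ)⟫_ℝ := by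
      conv_lhs => rw [e1, hysucc]
      rw [PiLp.add_apply, apply_two_eq_inner_e₃ d]
    rw [this]; linarith
  have hnotT : ¬ T k₁ := by
    intro hTk
    obtain ⟨hyX, -, hfar'⟩ := (hTdef k₁).1 hTk
    exact hfar' uᵢ hi hipos (far_mem hyX hk₁h (by linarith) (hylat k₁ hk₁K))
  -- the first step at which the twin-dozen structure is lost
  have hexbad : ∃ k, ¬ T k := ⟨k₁, hnotT⟩
  obtain ⟨kb, hkbdef⟩ : ∃ kb : ℕ, kb = Nat.find hexbad := ⟨_, rfl⟩
  have hkb_spec : ¬ T kb := by rw [hkbdef]; exact Nat.find_spec hexbad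
  have hkb_le : kb ≤ k₁ := by rw [hkbdef]; exact Nat.find_min' hexbad hnotT
  have hkb_pos : 0 < kb := by
    rcases Nat.eq_zero_or_pos kb with h0 | h
    · rw [h0] at hkb_spec; exact absurd hT0 hkb_spec
    · exact h
  have hprevT : T (kb - 1) := by
    have := Nat.find_min hexbad (show kb - 1 < Nat.find hexbad by rw [← hkbdef]; exact Nat.sub_lt hkb_pos Nat.one_pos)
    push Not at this; exact this
  obtain ⟨hyX, hown', hfar'⟩ := (hTdef (kb - 1)).1 hprevT
  have ekb : kb = (kb - 1) + 1 := (Nat.sub_add_cancel hkb_pos).symm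
  have hy' : y kb = y (kb - 1) + A (uᵢ - uⱼ) := by conv_lhs => rw [ekb, hysucc, hd]
  -- the next ball is in `X` (own slot of the twin dozen) but not a twin dozen
  have hy'X : y kb ∈ X := by
    rw [hy']; exact hown' _ hslot (by rw [← hd, hdn])
  have hnot12 : ¬ ((X.filter fun q => dist (y kb) q = 1).card = 12 ∧
      ∀ z ∈ X, dist (y kb) z = 1 → z ≠ y kb → (X.filter fun q => dist z q = 1).card = 12) := by
    rintro ⟨h12, hnb⟩
    apply hkb_spec
    rw [hy'] at h12 hnb
    obtain ⟨hown'', -, hfar''⟩ := twinDozen_inPlane_propagate hg hc hX A hn hmenu hyX hown' hfar' hi hj hij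
      hipos hjpos h12 (y (kb - 1) + A (uᵢ - uⱼ)) hnb
    refine (hTdef kb).2 ⟨hy'X, ?_, ?_⟩
    · rw [hy']; exact hown''
    · rw [hy']; exact hfar''
  -- the payer
  have hpay : ∃ z ∈ X, (X.filter fun q => dist z q = 1).card ≠ 12 ∧ (z = y kb ∨ dist (y kb) z = 1) := by
    by_cases h12 : (X.filter fun q => dist (y kb) q = 1).card = 12
    · have hnb : ¬ ∀ z ∈ X, dist (y kb) z = 1 → z ≠ y kb → (X.filter fun q => dist z q = 1).card = 12 :=
        fun h => hnot12 ⟨h12, h⟩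
      push Not at hnb
      obtain ⟨z, hzX, hdz, -, hz12⟩ := hnb
      exact ⟨z, hzX, hz12, Or.inr hdz⟩
    · exact ⟨y kb, hy'X, h12, Or.inl rfl⟩
  obtain ⟨z, hzX, hz12, hzy⟩ := hpay
  -- heights of `y kb`
  have hmono : (y kb) 2 ≤ e 2 := by
    rw [hyh]
    have h1 : (kb : ℝ) * ⟪d, EuclideanSpace.single (2 : Fin 3) (1 : ℝ)⟫_ℝ ≤ 0 :=
      mul_nonpos_iff.2 (Or.inl ⟨Nat.cast_nonneg kb, by linarith⟩)
    linarith
  have hlo : -R₀ - 2 < (y kb) 2 := by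
    rw [hyh]
    rw [hyh] at hk₁lo
    have hle : (kb : ℝ) ≤ k₁ := by exact_mod_cast hkb_le
    have h1 : ((k₁ : ℝ) - kb) * ⟪d, EuclideanSpace.single (2 : Fin 3) (1 : ℝ)⟫_ℝ ≤ 0 :=
      mul_nonpos_iff.2 (Or.inl ⟨by linarith, by linarith⟩)
    have h2 : ((k₁ : ℝ) - kb) * ⟪d, EuclideanSpace.single (2 : Fin 3) (1 : ℝ)⟫_ℝ =
        (k₁ : ℝ) * ⟪d, EuclideanSpace.single (2 : Fin 3) (1 : ℝ)⟫_ℝ -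
          (kb : ℝ) * ⟪d, EuclideanSpace.single (2 : Fin 3) (1 : ℝ)⟫_ℝ := by ring
    linarith
  refine ⟨uᵢ, hi, uⱼ, hj, kb, hkb_le.trans hk₁K, z, hzX, hz12, ?_, ?_, ?_⟩
  · rw [← hd, ← hydef]; exact hzy
  · rw [← hd, ← hydef]; exact hlo
  · rw [← hd, ← hydef]; exact hmono

end Summit.Ventures.Crystal3D.Theorems

end
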